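import Mathlib
import Summits.Ventures.PercRepro2.Defs
import Summits.Ventures.PercRepro2.Independence
import Summits.Ventures.PercRepro2.Harris
import Summits.Ventures.PercRepro2.Graph
import Summits.Ventures.PercRepro2.Exploration
import Summits.Ventures.PercRepro2.Events
import Summits.Ventures.PercRepro2.FourFunctions
import Summits.Ventures.PercRepro2.Induced
import Summits.Ventures.PercRepro2.Frontier
import Summits.Ventures.PercRepro2.ObsIndependence
import Summits.Ventures.PercRepro2.BHK
import Summits.Ventures.PercRepro2.BHKEvents
import Summits.Ventures.PercRepro2.OrderPreservation
import Summits.Ventures.PercRepro2.OrderPreservationDual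
import Summits.Ventures.PercRepro2.VdBKahn
import Summits.Ventures.PercRepro2.BHKAvoid
import Summits.Ventures.PercRepro2.R2PrimeThreeReduction
import Summits.Ventures.PercRepro2.YBridge
import Summits.Ventures.PercRepro2.Yu1Functionals
import Summits.Ventures.PercRepro2.Yu1Events
import Summits.Ventures.PercRepro2.Yu1
import Summits.Ventures.PercRepro2.LBSplit
import Summits.Ventures.PercRepro2.YDelta
import Summits.Ventures.PercRepro2.YDeltaTools
import Summits.Ventures.PercRepro2.SD
import Summits.Ventures.PercRepro2.Lambda
import Summits.Ventures.PercRepro2.LambdaTau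
import Summits.Ventures.PercRepro2.LambdaSlack

/-!
# (ZΔ): the T2 crux of record after NEG-32 (blind cell PercRepro2, typer-1; lead g6 ruling
2026-08-22T23:00:51Z, CONJECTURES row 2′ZΔ)

NEG-32 (engine 22:50:31Z, lead exact re-derivation): (Yu1Δ) is FALSE at ordered near-ties
(c7_00514, weights (916,1023,1023,139,804,1,1023,999,317,988,1023,1023)/1024); what survives is the
SUM of the two slacks.  With `W = M₂ + Δ_T` (the light-exploration mass, `= E[ψ; R]`) and the
heavy-exploration mass `Wh = M₁ + Δ′_T = E[ψ_h; R_h]` (`massM2`/`deltaT` with the roles of `a₁, a₂`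
swapped):

* **`ZDelta`** `:= [(T_{l→h} − Δ_l) + (T_{h→l} − Δ_h)] · P(PD) ≤ [P(PD, o ∈ C₁) + P(PD, o ∈ C₂)] · W`
  — (Yu1Δ)-slack + (Yu2Δ)-slack `≥ 0`; `ZDelta_of_Yu1Delta_Yu2Delta`; closure `ZDelta_all`
  (under the labelling `P(b ↔ a₁) ≤ P(b ↔ a₂)`).
* **`gap_eq`**: `W − Wh = P(a₂ ↔ b) − P(a₁ ↔ b)` — the unconditional labelling gap, exactly
  (three-way splits of `P(a_i ↔ b)` along `{a₁ ↔ a₂}`, `T`/`T′`, `R`/`R_h`).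
* **`Z_identity`** (the statement of the open content): with `τ_l = W u − P(PD) ψ` (`Lambda.tau`)
  and the heavy mirror `τ_h = Wh u_h − P(PD) ψ_h` (`Lambda.tau` with the roles swapped), both
  mean-zero on their avoid-worlds,
  `Z-slack = E[1_o τ_l; R] + E[1_o τ_h; R_h] + P(PD, o ∈ C₂) · (P(a₂ ↔ b) − P(a₁ ↔ b))`;
  `ZDelta_iff_identity` restates `ZDelta` as the non-negativity of that sum.
-/

namespace Summit.Ventures.PercRepro2

open UnionCluster Yu1

section ZDeltaDefs

variable {V : Type*} {E : Type*} [Fintype E] [DecidableEq E] [Fintype V] [DecidableEq V]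
  {R : Type*} [Field R] [LinearOrder R] [IsStrictOrderedRing R]

/-- **(ZΔ)** (row 2′ZΔ): the sum of the (Yu1Δ)- and (Yu2Δ)-slacks is non-negative —
`[(T_{l→h} − Δ_l) + (T_{h→l} − Δ_h)] · P(PD) ≤ [P(PD, o ∈ C₁) + P(PD, o ∈ C₂)] · W`. -/
def ZDelta (p : E → R) (ends : E → Sym2 V) (o a₁ a₂ a₃ b : V) : Prop :=
  ((prob p (PDEvent ends a₁ a₂ a₃ ∩ connEvent ends a₁ o ∩ connEvent ends a₂ b) -
        deltaL p ends o a₁ a₂ a₃ b) +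
      (prob p (PDEvent ends a₁ a₂ a₃ ∩ connEvent ends a₂ o ∩ connEvent ends a₁ b) -
        deltaH p ends o a₁ a₂ a₃ b)) * prob p (PDEvent ends a₁ a₂ a₃) ≤
    (prob p (PDEvent ends a₁ a₂ a₃ ∩ connEvent ends a₁ o) +
        prob p (PDEvent ends a₁ a₂ a₃ ∩ connEvent ends a₂ o)) *
      (massM2 p ends a₁ a₂ a₃ b + deltaT p ends a₁ a₂ a₃ b)

/-- The heavy-exploration mass `Wh = M₁ + Δ′_T = P(b ∈ C₁, R_h) − P(b ∈ C₂, T′)` (`massM2`, `deltaT`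
with the roles of `a₁, a₂` swapped). -/
noncomputable def Wh (p : E → R) (ends : E → Sym2 V) (a₁ a₂ a₃ b : V) : R :=
  massM2 p ends a₂ a₁ a₃ b + deltaT p ends a₂ a₁ a₃ b

omit [Fintype V] [DecidableEq V] in
/-- `ZDelta` from the two termwise rows. -/
theorem ZDelta_of_Yu1Delta_Yu2Delta (p : E → R) (ends : E → Sym2 V) {o a₁ a₂ a₃ b : V}
    (h1 : Yu1Delta p ends o a₁ a₂ a₃ b) (h2 : Yu2Delta p ends o a₁ a₂ a₃ b) :
    ZDelta p ends o a₁ a₂ a₃ b := by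
  unfold Yu1Delta at h1
  unfold Yu2Delta at h2
  unfold ZDelta
  nlinarith [h1, h2]

end ZDeltaDefs

section ZDeltaClosure

variable (R : Type*) [Field R] [LinearOrder R] [IsStrictOrderedRing R]

/-- **(ZΔ) for every finite graph** under the labelling `P(b ↔ a₁) ≤ P(b ↔ a₂)` (the T2 crux of
record, CONJECTURES row 2′ZΔ; census 0 violations on 66M exact instances + all near-tie searches). -/
def ZDelta_all : Prop :=
  ∀ (V E : Type) [Fintype V] [DecidableEq V] [Fintype E] [DecidableEq E]
    (ends : E → Sym2 V) (p : E → R), IsProbVec p →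
    ∀ o a₁ a₂ a₃ b : V, a₁ ≠ a₂ → a₁ ≠ a₃ → a₂ ≠ a₃ → o ≠ a₁ → o ≠ a₂ → o ≠ a₃ → o ≠ b →
      b ≠ a₁ → b ≠ a₂ → b ≠ a₃ →
      prob p (connEvent ends a₁ b) ≤ prob p (connEvent ends a₂ b) →
      ZDelta p ends o a₁ a₂ a₃ b

end ZDeltaClosure

section GapIdentity

variable {V : Type*} {E : Type*} [Fintype E] [DecidableEq E] [Fintype V] [DecidableEq V]
  {R : Type*} [Field R] [LinearOrder R] [IsStrictOrderedRing R]

omit [Fintype V] [LinearOrder R] [IsStrictOrderedRing R] in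
/-- Three-way split of `P(a₂ ↔ b)` along `{a₁ ↔ a₂}`, `T′ = {a₂ ∉ C₁, a₃ ∈ C₁}`, `R = {a₂, a₃ ∉ C₁}`:
`P(a₂ ↔ b) = P(b ∈ C₂, a₁ ↔ a₂) + P(b ∈ C₂, T′) + P(b ∈ C₂, R)`. -/
lemma prob_conn_split_heavy (p : E → R) (ends : E → Sym2 V) (a₁ a₂ a₃ b : V) :
    prob p (connEvent ends a₂ b) =
      prob p (connEvent ends a₂ b ∩ connEvent ends a₁ a₂) +
        prob p (connEvent ends a₂ b ∩ TEvent ends a₂ a₁ a₃) +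
        prob p (connEvent ends a₂ b ∩ avoidAll ends a₁ {a₂, a₃}) := by
  have s1 := prob_inter_add_prob_inter_compl p (connEvent ends a₂ b) (connEvent ends a₁ a₂)
  have s2 := prob_inter_add_prob_inter_compl p (connEvent ends a₂ b ∩ (connEvent ends a₁ a₂)ᶜ)
    (connEvent ends a₁ a₃)
  have e1 : connEvent ends a₂ b ∩ (connEvent ends a₁ a₂)ᶜ ∩ connEvent ends a₁ a₃ =
      connEvent ends a₂ b ∩ TEvent ends a₂ a₁ a₃ := by
    ext ω
    simp only [TEvent, Set.mem_inter_iff, Set.mem_compl_iff, mem_connEvent]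
    tauto
  have e2 : connEvent ends a₂ b ∩ (connEvent ends a₁ a₂)ᶜ ∩ (connEvent ends a₁ a₃)ᶜ =
      connEvent ends a₂ b ∩ avoidAll ends a₁ {a₂, a₃} := by
    ext ω
    simp only [avoidAll, Set.mem_inter_iff, Set.mem_compl_iff, mem_connEvent, Set.mem_setOf_eq,
      Finset.mem_insert, Finset.mem_singleton, forall_eq_or_imp, forall_eq]
    tauto
  rw [e1, e2] at s2
  linear_combination -s1 - s2

omit [Fintype V] [LinearOrder R] [IsStrictOrderedRing R] in
/-- Three-way split of `P(a₁ ↔ b)` along `{a₁ ↔ a₂}`, `T = {a₁ ∉ C₂, a₃ ∈ C₂}`, `R_h = {a₁, a₃ ∉ C₂}`: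
`P(a₁ ↔ b) = P(b ∈ C₁, a₁ ↔ a₂) + P(b ∈ C₁, T) + P(b ∈ C₁, R_h)`. -/
lemma prob_conn_split_light (p : E → R) (ends : E → Sym2 V) (a₁ a₂ a₃ b : V) :
    prob p (connEvent ends a₁ b) =
      prob p (connEvent ends a₁ b ∩ connEvent ends a₁ a₂) +
        prob p (connEvent ends a₁ b ∩ TEvent ends a₁ a₂ a₃) +
        prob p (connEvent ends a₁ b ∩ avoidAll ends a₂ {a₁, a₃}) := by
  have s1 := prob_inter_add_prob_inter_compl p (connEvent ends a₁ b) (connEvent ends a₁ a₂)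
  have s2 := prob_inter_add_prob_inter_compl p (connEvent ends a₁ b ∩ (connEvent ends a₁ a₂)ᶜ)
    (connEvent ends a₂ a₃)
  have e1 : connEvent ends a₁ b ∩ (connEvent ends a₁ a₂)ᶜ ∩ connEvent ends a₂ a₃ =
      connEvent ends a₁ b ∩ TEvent ends a₁ a₂ a₃ := by
    ext ω
    simp only [TEvent, Set.mem_inter_iff, Set.mem_compl_iff, mem_connEvent]
    constructor
    · rintro ⟨⟨hb, h12⟩, h23⟩
      exact ⟨hb, fun h => h12 (conn_symm h), h23⟩
    · rintro ⟨hb, h21, h23⟩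
      exact ⟨⟨hb, fun h => h21 (conn_symm h)⟩, h23⟩
  have e2 : connEvent ends a₁ b ∩ (connEvent ends a₁ a₂)ᶜ ∩ (connEvent ends a₂ a₃)ᶜ =
      connEvent ends a₁ b ∩ avoidAll ends a₂ {a₁, a₃} := by
    ext ω
    simp only [avoidAll, Set.mem_inter_iff, Set.mem_compl_iff, mem_connEvent, Set.mem_setOf_eq,
      Finset.mem_insert, Finset.mem_singleton, forall_eq_or_imp, forall_eq]
    constructor
    · rintro ⟨⟨hb, h12⟩, h23⟩
      exact ⟨hb, fun h => h12 (conn_symm h), h23⟩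
    · rintro ⟨hb, h21, h23⟩
      exact ⟨⟨hb, fun h => h21 (conn_symm h)⟩, h23⟩
  rw [e1, e2] at s2
  linear_combination -s1 - s2

omit [Fintype E] [DecidableEq E] [Fintype V] [DecidableEq V] in
/-- On `{a₁ ↔ a₂}`, `b ∈ C₂` and `b ∈ C₁` coincide. -/
lemma conn_b_inter_conn_swap (ends : E → Sym2 V) (a₁ a₂ b : V) :
    connEvent ends a₂ b ∩ connEvent ends a₁ a₂ = connEvent ends a₁ b ∩ connEvent ends a₁ a₂ := by
  ext ω
  simp only [Set.mem_inter_iff, mem_connEvent]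
  constructor
  · rintro ⟨hb, h12⟩
    exact ⟨conn_trans h12 hb, h12⟩
  · rintro ⟨hb, h12⟩
    exact ⟨conn_trans (conn_symm h12) hb, h12⟩

omit [Fintype V] [LinearOrder R] [IsStrictOrderedRing R] in
/-- **`W − Wh = P(a₂ ↔ b) − P(a₁ ↔ b)`**: the two exploration masses differ by exactly the
unconditional labelling gap. -/
theorem gap_eq (p : E → R) (ends : E → Sym2 V) (a₁ a₂ a₃ b : V) :
    (massM2 p ends a₁ a₂ a₃ b + deltaT p ends a₁ a₂ a₃ b) - Wh p ends a₁ a₂ a₃ b =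
      prob p (connEvent ends a₂ b) - prob p (connEvent ends a₁ b) := by
  have hW : massM2 p ends a₁ a₂ a₃ b + deltaT p ends a₁ a₂ a₃ b =
      prob p (connEvent ends a₂ b ∩ avoidAll ends a₁ {a₂, a₃}) -
        prob p (connEvent ends a₁ b ∩ TEvent ends a₁ a₂ a₃) := by
    rw [Nh_eq p ends a₁ a₂ a₃ b]
    unfold deltaT
    ring
  have hWh : Wh p ends a₁ a₂ a₃ b =
      prob p (connEvent ends a₁ b ∩ avoidAll ends a₂ {a₁, a₃}) -
        prob p (connEvent ends a₂ b ∩ TEvent ends a₂ a₁ a₃) := by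
    unfold Wh
    rw [Nh_eq p ends a₂ a₁ a₃ b]
    unfold deltaT
    ring
  rw [hW, hWh, prob_conn_split_heavy p ends a₁ a₂ a₃ b, prob_conn_split_light p ends a₁ a₂ a₃ b,
    conn_b_inter_conn_swap]
  ring

end GapIdentity

section ZIdentity

variable {V : Type*} {E : Type*} [Fintype E] [DecidableEq E] [Fintype V] [DecidableEq V]
  {R : Type*} [Field R] [LinearOrder R] [IsStrictOrderedRing R]

omit [LinearOrder R] [IsStrictOrderedRing R] in
/-- The heavy slack with the heavy mass: `P(PD, o ∈ C₂) Wh + Δ_h P(PD) − T_{h→l} P(PD)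
= E[1_o(C₂) τ_h(C₂); R_h]`, `τ_h = Wh u_h − P(PD) ψ_h` (`slack_eq_expect_tau` with the roles of
`a₁, a₂` swapped). -/
theorem heavy_slack_eq_expect_tau (p : E → R) (ends : E → Sym2 V) (o a₁ a₂ a₃ b : V) :
    prob p (PDEvent ends a₁ a₂ a₃ ∩ connEvent ends a₂ o) * Wh p ends a₁ a₂ a₃ b +
        deltaH p ends o a₁ a₂ a₃ b * prob p (PDEvent ends a₁ a₂ a₃) -
      prob p (PDEvent ends a₁ a₂ a₃ ∩ connEvent ends a₂ o ∩ connEvent ends a₁ b) *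
        prob p (PDEvent ends a₁ a₂ a₃) =
      expect p (fun ω => ind o (cluster ends ω a₂) *
        Lambda.tau p ends a₂ a₁ a₃ b (cluster ends ω a₂) *
        (avoidAll ends a₂ {a₁, a₃}).indicator 1 ω) := by
  have h := Lambda.slack_eq_expect_tau p ends o a₂ a₁ a₃ b
  rw [PDEvent_symm] at h
  unfold Wh
  exact h

omit [LinearOrder R] [IsStrictOrderedRing R] in
/-- **The Z-identity** (lead 23:00:51Z): the (ZΔ)-slack is
`E[1_o τ_l; R] + E[1_o τ_h; R_h] + P(PD, o ∈ C₂) · (P(a₂ ↔ b) − P(a₁ ↔ b))`. -/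
theorem Z_identity (p : E → R) (ends : E → Sym2 V) (o a₁ a₂ a₃ b : V) :
    (prob p (PDEvent ends a₁ a₂ a₃ ∩ connEvent ends a₁ o) +
          prob p (PDEvent ends a₁ a₂ a₃ ∩ connEvent ends a₂ o)) *
        (massM2 p ends a₁ a₂ a₃ b + deltaT p ends a₁ a₂ a₃ b) -
      ((prob p (PDEvent ends a₁ a₂ a₃ ∩ connEvent ends a₁ o ∩ connEvent ends a₂ b) -
            deltaL p ends o a₁ a₂ a₃ b) +
          (prob p (PDEvent ends a₁ a₂ a₃ ∩ connEvent ends a₂ o ∩ connEvent ends a₁ b) -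
            deltaH p ends o a₁ a₂ a₃ b)) * prob p (PDEvent ends a₁ a₂ a₃) =
      expect p (fun ω => ind o (cluster ends ω a₁) *
          Lambda.tau p ends a₁ a₂ a₃ b (cluster ends ω a₁) *
          (avoidAll ends a₁ {a₂, a₃}).indicator 1 ω) +
        expect p (fun ω => ind o (cluster ends ω a₂) *
          Lambda.tau p ends a₂ a₁ a₃ b (cluster ends ω a₂) *
          (avoidAll ends a₂ {a₁, a₃}).indicator 1 ω) +
        prob p (PDEvent ends a₁ a₂ a₃ ∩ connEvent ends a₂ o) *
          (prob p (connEvent ends a₂ b) - prob p (connEvent ends a₁ b)) := by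
  have hl := Lambda.slack_eq_expect_tau p ends o a₁ a₂ a₃ b
  have hh := heavy_slack_eq_expect_tau p ends o a₁ a₂ a₃ b
  have hg := gap_eq p ends a₁ a₂ a₃ b
  rw [← hl, ← hh, ← hg]
  ring

omit [LinearOrder R] [IsStrictOrderedRing R] in
/-- `E[τ_h; R_h] = 0` (the heavy weight is mean-zero on its avoid-world). -/
theorem expect_tauH_eq_zero (p : E → R) (ends : E → Sym2 V) (a₁ a₂ a₃ b : V) :
    expect p (fun ω => Lambda.tau p ends a₂ a₁ a₃ b (cluster ends ω a₂) *
      (avoidAll ends a₂ {a₁, a₃}).indicator 1 ω) = 0 :=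
  Lambda.expect_tau_eq_zero p ends a₂ a₁ a₃ b

/-- **(ZΔ) as the non-negativity of the three-term identity**. -/
theorem ZDelta_iff_identity (p : E → R) (ends : E → Sym2 V) (o a₁ a₂ a₃ b : V) :
    ZDelta p ends o a₁ a₂ a₃ b ↔
      0 ≤ expect p (fun ω => ind o (cluster ends ω a₁) *
            Lambda.tau p ends a₁ a₂ a₃ b (cluster ends ω a₁) *
            (avoidAll ends a₁ {a₂, a₃}).indicator 1 ω) +
          expect p (fun ω => ind o (cluster ends ω a₂) *
            Lambda.tau p ends a₂ a₁ a₃ b (cluster ends ω a₂) *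
            (avoidAll ends a₂ {a₁, a₃}).indicator 1 ω) +
          prob p (PDEvent ends a₁ a₂ a₃ ∩ connEvent ends a₂ o) *
            (prob p (connEvent ends a₂ b) - prob p (connEvent ends a₁ b)) := by
  rw [← Z_identity]
  unfold ZDelta
  constructor
  · intro h
    linarith
  · intro h
    linarith

end ZIdentity

end Summit.Ventures.PercRepro2
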